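import Summits.CriticalPhenomena.PercolationContinuityZ3.Theorems.Transplant.FKDoubleFanSameTwoA
import Summits.CriticalPhenomena.PercolationContinuityZ3.Theorems.Transplant.FKDoubleFanSpokesAdjacent
import HarnessLib

/-!
# Double fans: two spokes of the same apex at rim vertices two apart — part B: the STRUCTURAL reduction (edges of the square, the mixed term)

Helper file (`--supports stmt-CriticalPhenomena-4575`), FK sub-lane `prim-bschramm-fk-3` (gen 22); builds on p205010 (kernel theorem, internal
audit signed; external expert review pending).  Pure real algebra: no measures, no named facts, no sorries; standard axioms.  Memo
`bschramm/prim-bschramm-fk-3/SAME-TWO.md`.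
Setting of `…SameTwoA`: `Z^{αβ}(r₁,r₂) = sameTwoZ q x y r₁ r₂ u s α β = val_q(s ∗ AC^β ∗ E_{r₂} ∗ AC(x)BC(y) ∗ E_{r₁} ∗ AC^α u)`, the two `a`-spokes
`e = a c_i` (`α`), `f = a c_{i+2}` (`β`) with the rim edges `r₁, r₂` and the middle spokes `x, y` between them.  Instead of the 81-piece tensor-Bernstein
certificate of gen 21 (memo `RIM-PAIRS.md` §4, §6: not landable), the Rayleigh difference `Δ(r₁,r₂) = Z¹⁰Z⁰¹ − Z¹¹Z⁰⁰` is split along the FIRST rim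
edge only (**`rayleigh_sameTwo_decomp`**): `Δ = (1−r₁)²·Δ(0,r₂) + r₁²·Δ(1,r₂) + r₁(1−r₁)·Θ(r₂)`, and the three coefficients are structural:
* `r₁ = 1` (rim edge contracted): the configuration IS the adjacent pair of `…SpokesAdjacent` with the middle spokes moved into the prefix
  (`sameTwoZ_r1_one`), so `Δ(1,r₂) ≥ 0` (**`rayleigh_sameTwo_r1_one_nonneg`**);
* `r₁ = 0` (rim edge deleted): a TWO-SUM — `detach` has rank two, the four `Z^{αβ}` factor through the plane `⟨e_0, e_ab⟩`
  (`sameTwoZ_r1_zero`), and `Δ(0,r₂) = q²(1−q)·N^{(bc)}(u)·N^{(bc)}(R)` with `R = s ∗ E_{r₂} ∗ AC(x)BC(y) δ_0` (**`rayleigh_sameTwo_r1_zero_eq`**,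
  from the `2 × 2` determinant `c¹d⁰ − c⁰d¹ = −N^{(bc)}(u)` of the detached frame and the axis–spoke identity `rayleigh_AB_AC_eq`); `≥ 0` on valid vectors;
* the mixed term `Θ(r₂) = [Z(0,·), Z(1,·)]` (**`sameTwoTheta`**) is reduced in part C to a `6 × 6` bilinear form in the products
  `z_i·(z_0+z_ac)`, `z_i·(z_ab+z_bc+z_1)` (`i ∈ {0, ab, bc}`) of `u` and of `s` and certified there; this file provides its linear-algebra skeleton:
  the second-half context `sameTwoCtx` (linear: `sameTwoCtx_lin`) and `Θ` as a polynomial in the ten context values (`sameTwoTheta_eq_ctx`).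
[cite: Grimmett2006, §3.9 eq. (3.94) (pp. 63–64)] [cite: Wagner2006, Conj. 5.3 (p. 13)] [folklore]
-/

noncomputable section

namespace Summit.CriticalPhenomena.PercolationContinuityZ3.Theorems

namespace FK

namespace ThreeApex

/-! ### `r₁ = 1`: the adjacent pair with the middle spokes in the prefix -/

/-- With the first rim edge contracted, `Z^{αβ}` is the adjacent-pair partition function of `…SpokesAdjacent` for the prefix
`AC(x) BC(y) u`. [folklore] -/
theorem sameTwoZ_r1_one (q x y r₂ : ℝ) (u s : V5) (α β : ℝ) :
    sameTwoZ q x y 1 r₂ u s α β = spokesAZ q r₂ (conv (edgeAC x) (conv (edgeBC y) u)) s α β := by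
  simp only [sameTwoZ, spokesAZ, rimStep_one]
  rw [conv_comm (edgeBC y) (edgeAC α), conv_comm (edgeAC x) (edgeAC α)]

/-- `Δ(1, r₂) ≥ 0` for valid `u, s` and `q, x, y, r₂ ∈ [0,1]`. [folklore] -/
theorem rayleigh_sameTwo_r1_one_nonneg {q x y r₂ : ℝ} (hq0 : 0 ≤ q) (hq1 : q ≤ 1) (hx0 : 0 ≤ x) (hx1 : x ≤ 1) (hy0 : 0 ≤ y) (hy1 : y ≤ 1)
    (hr0 : 0 ≤ r₂) (hr1 : r₂ ≤ 1) {u s : V5} (hu : Valid q u) (hs : Valid q s) :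
    0 ≤ sameTwoZ q x y 1 r₂ u s 1 0 * sameTwoZ q x y 1 r₂ u s 0 1 - sameTwoZ q x y 1 r₂ u s 1 1 * sameTwoZ q x y 1 r₂ u s 0 0 := by
  simp only [sameTwoZ_r1_one]
  have hu' : Valid q (conv (edgeAC x) (conv (edgeBC y) u)) :=
    ((IsLetter.ac hx0 hx1).valid hq0 hq1).conv hq0 (((IsLetter.bc hy0 hy1).valid hq0 hq1).conv hq0 hu)
  exact rayleigh_spokesA_adjacent_nonneg hq0 hq1 hr0 hr1 hu'.nonneg hs.nonneg hu'.nBC hs.nBC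

/-! ### `r₁ = 0`: the two-sum -/

/-- The rest seen by the pair {`ab`-type letter, spoke `a c_{i+2}`} once the first rim edge is deleted:
`R = s ∗ E_{r₂} ∗ AC(x) BC(y) δ_0`. [folklore] -/
def sameTwoRv (q x y r₂ : ℝ) (s : V5) : V5 := conv s (rimStep q r₂ (conv (edgeAC x) (conv (edgeBC y) delta0)))

/-- `R` is valid whenever `s` is (`q, x, y, r₂ ∈ [0,1]`). [folklore] -/
theorem valid_sameTwoRv {q x y r₂ : ℝ} (hq0 : 0 ≤ q) (hq1 : q ≤ 1) (hx0 : 0 ≤ x) (hx1 : x ≤ 1) (hy0 : 0 ≤ y) (hy1 : y ≤ 1)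
    (hr0 : 0 ≤ r₂) (hr1 : r₂ ≤ 1) {s : V5} (hs : Valid q s) : Valid q (sameTwoRv q x y r₂ s) :=
  hs.conv hq0 ((((IsLetter.ac hx0 hx1).valid hq0 hq1).conv hq0
    (((IsLetter.bc hy0 hy1).valid hq0 hq1).conv hq0 (valid_delta0 q))).rimStep hq0 hq1 hr0 hr1)

/-- The second-half context is linear on the plane `⟨e_0, e_ab⟩` (the image of `detach`), with values the two axis/spoke-pinned
valuations of `R`. [folklore] -/
theorem sameTwo_ctx_plane (q x y r₂ : ℝ) (s : V5) (β c d : ℝ) :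
    val q (conv s (conv (edgeAC β) (rimStep q r₂ (conv (edgeAC x) (conv (edgeBC y) ⟨c, d, 0, 0, 0⟩))))) =
      c * val q (conv (edgeAB 0) (conv (edgeAC β) (sameTwoRv q x y r₂ s)))
      + d * val q (conv (edgeAB 1) (conv (edgeAC β) (sameTwoRv q x y r₂ s))) := by
  simp only [sameTwoRv, val, conv, edgeAC, edgeBC, edgeAB, rimStep, delta0, V5.total]
  ring

/-- `detach` lands in the plane `⟨e_0, e_ab⟩`. [folklore] -/
theorem detach_eq_plane (q : ℝ) (Z : V5) : detach q Z = ⟨(detach q Z).z0, (detach q Z).zab, 0, 0, 0⟩ := by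
  ext <;> rfl

/-- **`r₁ = 0`: factorization through the plane.** `Z^{αβ}(0, r₂) = c^α·G_{0β} + d^α·G_{1β}` with `(c^α, d^α) = detach(AC^α u)` and
`G_{γβ} = val(AB^γ AC^β R)`. [folklore] -/
theorem sameTwoZ_r1_zero (q x y r₂ : ℝ) (u s : V5) (α β : ℝ) :
    sameTwoZ q x y 0 r₂ u s α β =
      (detach q (conv (edgeAC α) u)).z0 * val q (conv (edgeAB 0) (conv (edgeAC β) (sameTwoRv q x y r₂ s)))
      + (detach q (conv (edgeAC α) u)).zab * val q (conv (edgeAB 1) (conv (edgeAC β) (sameTwoRv q x y r₂ s))) := by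
  rw [sameTwoZ, rimStep_zero, detach_eq_plane, sameTwo_ctx_plane]

/-- The `2 × 2` determinant of the detached `a`-spoke frame is `−N^{(bc)}(u)`. [folklore] -/
theorem detach_frame_det (q : ℝ) (u : V5) :
    (detach q (conv (edgeAC 1) u)).z0 * (detach q (conv (edgeAC 0) u)).zab
        - (detach q (conv (edgeAC 0) u)).z0 * (detach q (conv (edgeAC 1) u)).zab = -masterN q (swapAB u) := by
  simp only [detach, conv, edgeAC, masterN, swapAB, V5.total]
  ring

/-- The axis/spoke Rayleigh identity with the letters in the order `AB^γ AC^β`: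
`val(AB⁰AC¹R)·val(AB¹AC⁰R) − val(AB¹AC¹R)·val(AB⁰AC⁰R) = q²(1−q)·N^{(bc)}(R)`. [folklore] -/
theorem rayleigh_AB_AC_eq (q : ℝ) (R : V5) :
    val q (conv (edgeAB 0) (conv (edgeAC 1) R)) * val q (conv (edgeAB 1) (conv (edgeAC 0) R)) -
        val q (conv (edgeAB 1) (conv (edgeAC 1) R)) * val q (conv (edgeAB 0) (conv (edgeAC 0) R)) =
      q ^ 2 * (1 - q) * masterN q (swapAB R) := by
  simp only [val, conv, edgeAB, edgeAC, masterN, swapAB, V5.total]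
  ring

/-- **`Δ(0, r₂) = q²(1−q)·N^{(bc)}(u)·N^{(bc)}(R)`** (the two-sum formula). [folklore] -/
theorem rayleigh_sameTwo_r1_zero_eq (q x y r₂ : ℝ) (u s : V5) :
    sameTwoZ q x y 0 r₂ u s 1 0 * sameTwoZ q x y 0 r₂ u s 0 1 - sameTwoZ q x y 0 r₂ u s 1 1 * sameTwoZ q x y 0 r₂ u s 0 0 =
      q ^ 2 * (1 - q) * masterN q (swapAB u) * masterN q (swapAB (sameTwoRv q x y r₂ s)) := by
  have hdet := detach_frame_det q u
  have hax := rayleigh_AB_AC_eq q (sameTwoRv q x y r₂ s)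
  rw [sameTwoZ_r1_zero, sameTwoZ_r1_zero, sameTwoZ_r1_zero, sameTwoZ_r1_zero]
  linear_combination
    (val q (conv (edgeAB 0) (conv (edgeAC 0) (sameTwoRv q x y r₂ s))) * val q (conv (edgeAB 1) (conv (edgeAC 1) (sameTwoRv q x y r₂ s)))
      - val q (conv (edgeAB 0) (conv (edgeAC 1) (sameTwoRv q x y r₂ s))) * val q (conv (edgeAB 1) (conv (edgeAC 0) (sameTwoRv q x y r₂ s))))
      * hdet + masterN q (swapAB u) * hax

/-- `Δ(0, r₂) ≥ 0` for valid `u, s` and `q, x, y, r₂ ∈ [0,1]`. [folklore] -/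
theorem rayleigh_sameTwo_r1_zero_nonneg {q x y r₂ : ℝ} (hq0 : 0 ≤ q) (hq1 : q ≤ 1) (hx0 : 0 ≤ x) (hx1 : x ≤ 1) (hy0 : 0 ≤ y) (hy1 : y ≤ 1)
    (hr0 : 0 ≤ r₂) (hr1 : r₂ ≤ 1) {u s : V5} (hu : Valid q u) (hs : Valid q s) :
    0 ≤ sameTwoZ q x y 0 r₂ u s 1 0 * sameTwoZ q x y 0 r₂ u s 0 1 - sameTwoZ q x y 0 r₂ u s 1 1 * sameTwoZ q x y 0 r₂ u s 0 0 := by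
  rw [rayleigh_sameTwo_r1_zero_eq]
  have h1 := hu.nBC
  have h2 := (valid_sameTwoRv hq0 hq1 hx0 hx1 hy0 hy1 hr0 hr1 hs).nBC
  have hq' : 0 ≤ 1 - q := sub_nonneg.2 hq1
  positivity

/-! ### The split along the first rim edge and the mixed term -/

/-- **The mixed term** `Θ(r₂) = [Z(0,·), Z(1,·)] = Z¹⁰(0)Z⁰¹(1) + Z¹⁰(1)Z⁰¹(0) − Z¹¹(0)Z⁰⁰(1) − Z¹¹(1)Z⁰⁰(0)`. [folklore] -/
def sameTwoTheta (q x y r₂ : ℝ) (u s : V5) : ℝ :=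
  sameTwoZ q x y 0 r₂ u s 1 0 * sameTwoZ q x y 1 r₂ u s 0 1 + sameTwoZ q x y 1 r₂ u s 1 0 * sameTwoZ q x y 0 r₂ u s 0 1
    - sameTwoZ q x y 0 r₂ u s 1 1 * sameTwoZ q x y 1 r₂ u s 0 0 - sameTwoZ q x y 1 r₂ u s 1 1 * sameTwoZ q x y 0 r₂ u s 0 0

/-- **Split along the first rim edge**: `Δ(r₁,r₂) = (1−r₁)²Δ(0,r₂) + r₁²Δ(1,r₂) + r₁(1−r₁)Θ(r₂)`. [folklore] -/
theorem rayleigh_sameTwo_decomp (q x y r₁ r₂ : ℝ) (u s : V5) :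
    sameTwoZ q x y r₁ r₂ u s 1 0 * sameTwoZ q x y r₁ r₂ u s 0 1 - sameTwoZ q x y r₁ r₂ u s 1 1 * sameTwoZ q x y r₁ r₂ u s 0 0 =
      (1 - r₁) ^ 2 * (sameTwoZ q x y 0 r₂ u s 1 0 * sameTwoZ q x y 0 r₂ u s 0 1 - sameTwoZ q x y 0 r₂ u s 1 1 * sameTwoZ q x y 0 r₂ u s 0 0)
      + r₁ ^ 2 * (sameTwoZ q x y 1 r₂ u s 1 0 * sameTwoZ q x y 1 r₂ u s 0 1 - sameTwoZ q x y 1 r₂ u s 1 1 * sameTwoZ q x y 1 r₂ u s 0 0)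
      + r₁ * (1 - r₁) * sameTwoTheta q x y r₂ u s := by
  rw [sameTwoZ_affine_r1 q x y r₁ r₂ u s 1 0, sameTwoZ_affine_r1 q x y r₁ r₂ u s 0 1, sameTwoZ_affine_r1 q x y r₁ r₂ u s 1 1,
    sameTwoZ_affine_r1 q x y r₁ r₂ u s 0 0]
  unfold sameTwoTheta
  ring

/-- **Reduction of the pair to the mixed term**: if `Θ(r₂) ≥ 0` then `Δ(r₁, r₂) ≥ 0` (valid `u, s`; `q, x, y, r₁, r₂ ∈ [0,1]`). [folklore] -/
theorem rayleigh_sameTwo_nonneg_of_theta {q x y r₁ r₂ : ℝ} (hq0 : 0 ≤ q) (hq1 : q ≤ 1) (hx0 : 0 ≤ x) (hx1 : x ≤ 1) (hy0 : 0 ≤ y)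
    (hy1 : y ≤ 1) (hr₁0 : 0 ≤ r₁) (hr₁1 : r₁ ≤ 1) (hr₂0 : 0 ≤ r₂) (hr₂1 : r₂ ≤ 1) {u s : V5} (hu : Valid q u) (hs : Valid q s)
    (hΘ : 0 ≤ sameTwoTheta q x y r₂ u s) :
    0 ≤ sameTwoZ q x y r₁ r₂ u s 1 0 * sameTwoZ q x y r₁ r₂ u s 0 1 - sameTwoZ q x y r₁ r₂ u s 1 1 * sameTwoZ q x y r₁ r₂ u s 0 0 := by
  rw [rayleigh_sameTwo_decomp]
  have h0 := rayleigh_sameTwo_r1_zero_nonneg hq0 hq1 hx0 hx1 hy0 hy1 hr₂0 hr₂1 hu hs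
  have h1 := rayleigh_sameTwo_r1_one_nonneg hq0 hq1 hx0 hx1 hy0 hy1 hr₂0 hr₂1 hu hs
  have hr' : 0 ≤ 1 - r₁ := sub_nonneg.2 hr₁1
  positivity

/-! ### The second-half context and the mixed term as a polynomial in its ten values -/

/-- The second-half context `X ↦ val(s ∗ AC^β ∗ E_{r₂} ∗ AC(x)BC(y) X)`; `Z^{αβ}(r₁,r₂)` is its value at `E_{r₁} AC^α u`. [folklore] -/
def sameTwoCtx (q x y r₂ : ℝ) (s : V5) (β : ℝ) (X : V5) : ℝ :=
  val q (conv s (conv (edgeAC β) (rimStep q r₂ (conv (edgeAC x) (conv (edgeBC y) X)))))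

/-- `Z^{αβ} = ctx_β(E_{r₁} AC^α u)`. [folklore] -/
theorem sameTwoZ_eq_ctx (q x y r₁ r₂ : ℝ) (u s : V5) (α β : ℝ) :
    sameTwoZ q x y r₁ r₂ u s α β = sameTwoCtx q x y r₂ s β (rimStep q r₁ (conv (edgeAC α) u)) := rfl

/-- The context is linear. [folklore] -/
theorem sameTwoCtx_lin (q x y r₂ : ℝ) (s : V5) (β : ℝ) (X : V5) :
    sameTwoCtx q x y r₂ s β X = X.z0 * sameTwoCtx q x y r₂ s β ⟨1, 0, 0, 0, 0⟩ + X.zab * sameTwoCtx q x y r₂ s β ⟨0, 1, 0, 0, 0⟩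
      + X.zac * sameTwoCtx q x y r₂ s β ⟨0, 0, 1, 0, 0⟩ + X.zbc * sameTwoCtx q x y r₂ s β ⟨0, 0, 0, 1, 0⟩
      + X.z1 * sameTwoCtx q x y r₂ s β ⟨0, 0, 0, 0, 1⟩ := by
  simp only [sameTwoCtx, val, conv, edgeAC, edgeBC, rimStep, V5.total]
  ring

end ThreeApex

end FK

end Summit.CriticalPhenomena.PercolationContinuityZ3.Theorems
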